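import Mathlib
import Summits.KontsevichZagierPeriods.KontsevichZagierPeriods.Theorems.InverseLandauTateFamilyKernelQhPencilFaceExact
import Summits.KontsevichZagierPeriods.KontsevichZagierPeriods.Theorems.InverseLandauTateFamilyKernelStubEulerBandMulti

/-!
# Crux `TateFamilyKernel` (stmt-KontsevichZagierPeriods-9130), line `Sketch` — glue
# `qhPencilMulti_mem_relations_of_faceExact` (wave 13, Euler sector: every numerator of a
# quasi-homogeneous pencil, modulo the exactness of the telescoped face family)

The MULTI-WEIGHT quasi-homogeneous pencil of the lead's skeleton of the crux
`Summit.KontsevichZagierPeriods.KontsevichZagierPeriods.Theses.InverseLandau.TateFamilyKernel`.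
Data: weights `a, b`, an exponent `d ≥ 1`, `T ∈ ℚ[z₀, z₁]` weighted-homogeneous of degree `d`, a
numerator `P = Σ_{w ∈ W} P_w` with `P_w` weighted-homogeneous of degree `w` and
`λ_w = w + a + b ≥ 1`, a real-algebraic `ϖ₀ > 0` with `1 − ϖ T(z) ≠ 0` on `[0,1]² × [0, ϖ₀]`, the
`δ = t∂_t`-tower `M w i` of the face families and a tame `s`-primitive `E` of the telescoped face
family with equal endpoint values. Conclusion: every tame cube representation `Φ` of the fibre
`P/(1 − ϖ₀T)` is a Kontsevich–Zagier relation.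

Composition of the landed steps of the Euler sector, summed over the weights `w ∈ W`:

* rule (1) (additivity of the integrand, `KZ.of_sub_sum_integrand_mem_relations`):
  `[Φ] − Σ_w [Φ_w] ∈ KZ.relations` for the tame fibres `Φ_w` of `P_w/(1 − ϖ₀T)`;
* (A) `stub_eulerAnchor` — `[Φ_w] − [r_w] ∈ KZ.relations` for the tame cube `r_w` on `[0,1]³`
  (Tate-anchored Newton–Leibniz in `t`);
* (B) `stub_eulerFaces` — `[r_w] − [rb_w] ∈ KZ.relations` for the tame face band `rb_w` on `[0,1]²`
  (divergence theorem on the 3-cube);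
* rule (1) again: `[rb] − Σ_w [rb_w] ∈ KZ.relations` for the summed band `rb` (one quotient of
  `ℚ`-polynomials: all the `rb_w` share the denominator `Q_a Q_b`);
* (C) `stub_eulerBandMulti` — `[rb] ∈ KZ.relations` (two Ayoub elements, given `E`).

All intermediate tame cubes exist by `exists_isTameCube_fibre` (file
`InverseLandauTateFamilyKernelTateAnchor.lean`); the admissibility bookkeeping is that of the
single-weight glue (`QhPencil.adm_cube_three`, `QhPencil.adm_face_zero`, `QhPencil.adm_face_one`,
file `InverseLandauTateFamilyKernelQhPencilFaceExact.lean`) plus the fibre denominator at `ϖ = ϖ₀`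
(`QhPencilMulti.adm_fibre`).

References: Kontsevich–Zagier 2001, §1.2 rules (1)–(3); Ayoub, EMS Newsl. 91 (2014), Def. 10.
Mathlib plus the landed sibling files; no named fact, no new definition. Helpers live in the
sub-namespace `QhPencilMulti`.
-/

noncomputable section

open MeasureTheory Set MvPolynomial
open Literature.NumberTheory.Transcendental

namespace Summit.KontsevichZagierPeriods.InverseLandau.TateFamilyKernel.Descent

namespace QhPencilMulti

/-- **Admissibility of the fibre denominator.** If `1 − ϖT(z) ≠ 0` for `z ∈ [0,1]²`,
`ϖ ∈ [0, ϖ₀]` (`ϖ₀ > 0`), then the 3-variable datum `1 − X₂·T` does not vanish at `(z, ϖ₀)`,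
`z ∈ [0,1]²`. [folklore] -/
theorem adm_fibre {T : MvPolynomial (Fin 2) ℚ} {ϖ₀ : ℝ} (hϖ₀ : 0 < ϖ₀)
    (hadm : ∀ z ∈ KZ.cube 2, ∀ ϖ ∈ Icc (0 : ℝ) ϖ₀, 1 - ϖ * aeval z T ≠ 0) (z : Fin 2 → ℝ)
    (hz : z ∈ KZ.cube 2) :
    aeval (Fin.snoc z ϖ₀ : Fin (2 + 1) → ℝ) (1 - X 2 * rename Fin.castSucc T) ≠ 0 := by
  have h := hadm z hz ϖ₀ ⟨hϖ₀.le, le_rfl⟩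
  simpa only [map_sub, map_mul, map_one, aeval_X, EulerDivergence.snoc_apply_two,
    LinMoments.aeval_snoc_rename_castSucc] using h

/-- **Additivity of the integrand over a finite family of tame cubes** (rule (1), iterated): if the
tame cube `r` and the tame cubes `R i` (`i ∈ s`) satisfy `r.integrand = Σ_{i ∈ s} (R i).integrand`
on `[0,1]ⁿ`, then `[r] − Σ_{i ∈ s} [R i] ∈ KZ.relations`.
[cite: KontsevichZagier2001, §1.2 rule (1)] -/
theorem of_sub_sum_mem_relations {ι : Type*} (s : Finset ι) {n : ℕ} (R : ι → KZ.IntegralRep n)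
    (r : KZ.IntegralRep n) (hr : r.IsTameCube) (hR : ∀ i ∈ s, (R i).IsTameCube)
    (h : ∀ x ∈ KZ.cube n, r.integrand x = ∑ i ∈ s, (R i).integrand x) :
    KZ.of r - ∑ i ∈ s, KZ.of (R i) ∈ KZ.relations :=
  KZ.of_sub_sum_integrand_mem_relations s R r (fun i hi => (hR i hi).1.trans hr.1.symm)
    fun x hx => h x (hr.1 ▸ hx)

end QhPencilMulti

/-- **Quasi-homogeneous pencils, EVERY numerator, modulo the exactness of the telescoped face
family** (wave 13 glue of the Euler sector). For `T` weighted-homogeneous (weights `a, b`, degree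
`d ≥ 1`), `P = Σ_{w∈W} P_w` with `P_w` weighted-homogeneous of weight `w` and `w + a + b ≥ 1`,
`Q = 1 − ϖT` admissible on `[0,1]² × [0,ϖ₀]` (`ϖ₀ > 0` real-algebraic), the `δ`-tower `M` of the
face families and a tame `s`-primitive `E` of the telescoped face family `ĵ_L` with equal endpoint
values: every tame cube representation of the fibre `P/(1 − ϖ₀T)` is a KZ relation. Proof:
integrand additivity over `w ∈ W` (`KZ.of_sub_sum_integrand_mem_relations`); per weight the landed
`stub_eulerAnchor` (A) and `stub_eulerFaces` (B); additivity again to the summed band; then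
`stub_eulerBandMulti` for the summed band. [cite: KontsevichZagier2001, §1.2] -/
theorem qhPencilMulti_mem_relations_of_faceExact (a b d : ℕ) (hd : 0 < d) (T : MvPolynomial (Fin 2) ℚ)
    (hT : T.IsWeightedHomogeneous (![a, b] : Fin 2 → ℕ) d) (W : Finset ℕ) (Pw : ℕ → MvPolynomial (Fin 2) ℚ)
    (hPw : ∀ w ∈ W, (Pw w).IsWeightedHomogeneous (![a, b] : Fin 2 → ℕ) w) (hW : ∀ w ∈ W, 1 ≤ w + a + b)
    (ϖ₀ : ℝ) (halg : IsAlgebraic ℚ ϖ₀) (hϖ₀ : 0 < ϖ₀)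
    (hadm : ∀ z ∈ KZ.cube 2, ∀ ϖ ∈ Icc (0 : ℝ) ϖ₀, 1 - ϖ * aeval z T ≠ 0)
    (M : ℕ → ℕ → MvPolynomial (Fin (2 + 1)) ℚ)
    (hM0 : ∀ w, M w 0 =
      C (a : ℚ) * bind₁ ![C 1, X 0] (Pw w) * (1 - X 2 * X 1 ^ d * bind₁ ![X 0, C 1] T) + C (b : ℚ) * bind₁ ![X 0, C 1] (Pw w) * (1 - X 2 * X 1 ^ d * bind₁ ![C 1, X 0] T))
    (hMS : ∀ w i, M w (i + 1) =
      X 1 * (pderiv 1 (M w i) * ((1 - X 2 * X 1 ^ d * bind₁ ![C 1, X 0] T) * (1 - X 2 * X 1 ^ d * bind₁ ![X 0, C 1] T)) - C ((i : ℚ) + 1) * M w i * pderiv 1 ((1 - X 2 * X 1 ^ d * bind₁ ![C 1, X 0] T) * (1 - X 2 * X 1 ^ d * bind₁ ![X 0, C 1] T))))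
    (E : (Fin 2 → ℝ) → ℝ) (hEa : AnalyticOnNhd ℝ E (KZ.cube 2)) (hEs : IsSemialgebraicFunOn ℚ (KZ.cube 2) E)
    (hE : ∀ y ∈ KZ.cube 2, HasDerivAt (fun σ : ℝ => E (Function.update y 0 σ))
      (∑ w ∈ W, ∑ i ∈ Finset.range W.card,
        (((∏ v ∈ W.erase w, (Polynomial.X + Polynomial.C ((v + a + b : ℕ) : ℚ))).coeff i : ℚ) : ℝ) *
          (aeval (Fin.snoc y ϖ₀ : Fin (2 + 1) → ℝ) (M w i) /
            aeval (Fin.snoc y ϖ₀ : Fin (2 + 1) → ℝ) (((1 - X 2 * X 1 ^ d * bind₁ ![C 1, X 0] T) * (1 - X 2 * X 1 ^ d * bind₁ ![X 0, C 1] T)) ^ (i + 1)))) (y 0))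
    (hE01 : ∀ y ∈ KZ.cube 2, E (Function.update y 0 1) = E (Function.update y 0 0))
    (Φ : KZ.IntegralRep 2) (hΦ : Φ.IsTameCube)
    (hΦi : ∀ z ∈ KZ.cube 2, Φ.integrand z =
      aeval (Fin.snoc z ϖ₀ : Fin (2 + 1) → ℝ) (rename Fin.castSucc (∑ w ∈ W, Pw w)) /
        aeval (Fin.snoc z ϖ₀ : Fin (2 + 1) → ℝ) (1 - X 2 * rename Fin.castSucc T)) :
    KZ.of Φ ∈ KZ.relations := by
  classical
  -- (0) admissibility: the reparametrised pencil on `[0,1]³`, its two faces on `[0,1]²`, the fibre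
  have hadm4 : ∀ x ∈ KZ.cube 3, aeval (Fin.snoc x ϖ₀ : Fin (3 + 1) → ℝ)
      (1 - X 3 * X 2 ^ d * rename (Fin.castLE (show 2 ≤ 4 by norm_num)) T) ≠ 0 :=
    QhPencil.adm_cube_three d hϖ₀ hadm
  have hadmA : ∀ y ∈ KZ.cube 2, aeval (Fin.snoc y ϖ₀ : Fin (2 + 1) → ℝ)
      (1 - X 2 * X 1 ^ d * bind₁ ![C 1, X 0] T) ≠ 0 :=
    QhPencil.adm_face_zero d hϖ₀ hadm
  have hadmB : ∀ y ∈ KZ.cube 2, aeval (Fin.snoc y ϖ₀ : Fin (2 + 1) → ℝ)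
      (1 - X 2 * X 1 ^ d * bind₁ ![X 0, C 1] T) ≠ 0 :=
    QhPencil.adm_face_one d hϖ₀ hadm
  have hQ1 : ∀ z ∈ KZ.cube 2, aeval (Fin.snoc z ϖ₀ : Fin (2 + 1) → ℝ)
      (1 - X 2 * rename Fin.castSucc T) ≠ 0 :=
    QhPencilMulti.adm_fibre hϖ₀ hadm
  have hQ2 : ∀ x ∈ KZ.cube 3, aeval (Fin.snoc x ϖ₀ : Fin (3 + 1) → ℝ)
      ((1 - X 3 * X 2 ^ d * rename (Fin.castLE (show 2 ≤ 4 by norm_num)) T) ^ 2) ≠ 0 :=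
    fun x hx => by
      rw [map_pow]
      exact pow_ne_zero 2 (hadm4 x hx)
  have hQab : ∀ y ∈ KZ.cube 2, aeval (Fin.snoc y ϖ₀ : Fin (2 + 1) → ℝ)
      ((1 - X 2 * X 1 ^ d * bind₁ ![C 1, X 0] T) * (1 - X 2 * X 1 ^ d * bind₁ ![X 0, C 1] T)) ≠ 0 :=
    fun y hy => by
      rw [map_mul]
      exact mul_ne_zero (hadmA y hy) (hadmB y hy)
  -- (1) per weight: the tame fibre `Φ_w`, the tame cube `r_w` on `[0,1]³`, the face band `rb_w`
  choose Φf hΦf hΦfi using fun w : ℕ =>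
    exists_isTameCube_fibre (rename Fin.castSucc (Pw w)) (1 - X 2 * rename Fin.castSucc T) halg hQ1
  choose rbox hrbox hrboxi using fun w : ℕ => exists_isTameCube_fibre
    (X 2 ^ (w + a + b - 1) *
      (C ((w + a + b : ℕ) : ℚ) * rename (Fin.castLE (show 2 ≤ 4 by norm_num)) (Pw w) *
          (1 - X 3 * X 2 ^ d * rename (Fin.castLE (show 2 ≤ 4 by norm_num)) T) +
        C ((d : ℕ) : ℚ) * X 3 * X 2 ^ d * rename (Fin.castLE (show 2 ≤ 4 by norm_num)) (Pw w) *
          rename (Fin.castLE (show 2 ≤ 4 by norm_num)) T))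
    _ halg hQ2
  choose rband hrband hrbandi using fun w : ℕ => exists_isTameCube_fibre
    (X 1 ^ (w + a + b - 1) *
      (C (a : ℚ) * bind₁ ![C 1, X 0] (Pw w) * (1 - X 2 * X 1 ^ d * bind₁ ![X 0, C 1] T) +
        C (b : ℚ) * bind₁ ![X 0, C 1] (Pw w) * (1 - X 2 * X 1 ^ d * bind₁ ![C 1, X 0] T)))
    _ halg hQab
  -- (2) per weight: (A) the Tate-anchored Newton–Leibniz move and (B) the divergence theorem
  have h₁ : ∀ w ∈ W, KZ.of (Φf w) - KZ.of (rbox w) ∈ KZ.relations := fun w hw =>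
    stub_eulerAnchor a b d w hd (hW w hw) T (Pw w) ϖ₀ halg hadm4 (Φf w) (hΦf w)
      (fun x _ => by rw [hΦfi]) (rbox w) (hrbox w) (fun x _ => by rw [hrboxi])
  have h₂ : ∀ w ∈ W, KZ.of (rbox w) - KZ.of (rband w) ∈ KZ.relations := fun w hw =>
    stub_eulerFaces a b d w hd (hW w hw) T (Pw w) hT (hPw w hw) ϖ₀ halg hadm4 (rbox w) (hrbox w)
      (fun x _ => by rw [hrboxi]) (rband w) (hrband w) (fun y _ => by rw [hrbandi])
  -- (3) the summed face band `rb`: one quotient with the common denominator `Q_a Q_b`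
  obtain ⟨rb, hrb, hrbi⟩ := exists_isTameCube_fibre
    (∑ w ∈ W, X 1 ^ (w + a + b - 1) *
      (C (a : ℚ) * bind₁ ![C 1, X 0] (Pw w) * (1 - X 2 * X 1 ^ d * bind₁ ![X 0, C 1] T) +
        C (b : ℚ) * bind₁ ![X 0, C 1] (Pw w) * (1 - X 2 * X 1 ^ d * bind₁ ![C 1, X 0] T)))
    _ halg hQab
  have hrbi' : ∀ y ∈ KZ.cube 2, rb.integrand y =
      ∑ w ∈ W, aeval (Fin.snoc y ϖ₀ : Fin (2 + 1) → ℝ)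
          (X 1 ^ (w + a + b - 1) *
            (C (a : ℚ) * bind₁ ![C 1, X 0] (Pw w) * (1 - X 2 * X 1 ^ d * bind₁ ![X 0, C 1] T) +
              C (b : ℚ) * bind₁ ![X 0, C 1] (Pw w) * (1 - X 2 * X 1 ^ d * bind₁ ![C 1, X 0] T))) /
        aeval (Fin.snoc y ϖ₀ : Fin (2 + 1) → ℝ)
          ((1 - X 2 * X 1 ^ d * bind₁ ![C 1, X 0] T) * (1 - X 2 * X 1 ^ d * bind₁ ![X 0, C 1] T)) :=
    fun y _ => by
      rw [hrbi]
      simp only [map_sum, Finset.sum_div]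
  have h₃ : KZ.of rb ∈ KZ.relations :=
    stub_eulerBandMulti a b d hd T W Pw hW ϖ₀ halg hadmA hadmB M hM0 hMS E hEa hEs hE hE01 rb hrb hrbi'
  -- (4) additivity of the integrand over `w ∈ W`, for the fibre and for the band
  have h₀ : KZ.of Φ - ∑ w ∈ W, KZ.of (Φf w) ∈ KZ.relations :=
    QhPencilMulti.of_sub_sum_mem_relations W Φf Φ hΦ (fun w _ => hΦf w) fun z hz => by
      rw [hΦi z hz, map_sum, map_sum, Finset.sum_div]
      exact Finset.sum_congr rfl fun w _ => by rw [hΦfi]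
  have h₄ : KZ.of rb - ∑ w ∈ W, KZ.of (rband w) ∈ KZ.relations :=
    QhPencilMulti.of_sub_sum_mem_relations W rband rb hrb (fun w _ => hrband w) fun y hy => by
      rw [hrbi' y hy]
      exact Finset.sum_congr rfl fun w _ => by rw [hrbandi]
  -- (5) assemble
  have key : KZ.of Φ = (KZ.of Φ - ∑ w ∈ W, KZ.of (Φf w)) +
      ∑ w ∈ W, ((KZ.of (Φf w) - KZ.of (rbox w)) + (KZ.of (rbox w) - KZ.of (rband w))) -
      (KZ.of rb - ∑ w ∈ W, KZ.of (rband w)) + KZ.of rb := by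
    simp only [Finset.sum_add_distrib, Finset.sum_sub_distrib]
    abel
  rw [key]
  exact KZ.relations.add_mem (KZ.relations.sub_mem (KZ.relations.add_mem h₀
    (sum_mem fun w hw => KZ.relations.add_mem (h₁ w hw) (h₂ w hw))) h₄) h₃

end Summit.KontsevichZagierPeriods.InverseLandau.TateFamilyKernel.Descent

end
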